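import Summits.HodgeConjecture.HodgeConjecture.Theorems.VHCAbelianSchemesRoadEllipticTensorWeilAnchors
import Literature.AlgebraicGeometry.Andre1996.SplitWeilClassesWeilTensorPencil
import Literature.AlgebraicGeometry.Deligne1982.WeilTypeCMWeilClassesHodge
import HarnessLib

/-!
# Road b02 (`VHCAbelianSchemesRoad`) × the André column — SPLIT `E`-WEIL CLASSES, EVERY CM FIELD, from the door and carriers for `E`-Weil
# classes at `E`-tensor points over ONE elliptic curve (no CM hypothesis on the variety, no `HC_CM`, no cell, no residual)

research route, not a corollary; conditional on HC_CM plus one named minimal statement.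

PART AC-f (`VHCAbelianSchemesRoadEllipticTensorWeilAnchors`, gen 60) derived `HC_CM` from the door and the node «carriers for the RATIONAL `E`-WEIL
classes of CM-field structures on polarised abelian varieties isogenous to powers of ONE elliptic curve `E₀`» (`Ring2.AbelianAll.EllipticTensorWeilCarriers
𝒪 E₀`), through Lemmes 6.3.2 + 6.3.3 for CM abelian varieties (`andre1996_cmHodgeClasses_weilTensorPencils`). Lemme 6.3.3 by itself makes NO CM
hypothesis: it is a statement about Weil classes of SPLIT Weil structures `(B, E, (*))` relative to a CM field `E` of any degree, and its pencil has
the SAME special fibre — the tensor point `V₀ ⊗ E` over a prescribed `E₀` (named fact `Andre1996.andre1996_splitWeilClasses_weilTensorPencil`, statement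
only, this generation; hypotheses verbatim those of the literature seat's `andre1996_splitWeilClasses_algebraicallyAnchoredPencil`). Hence THE SAME
carrier node serves a second axis. This file proves, fact-free apart from the displayed named facts:

* §0 the new fact implies the literature seat's `andre1996_splitWeilClasses_algebraicallyAnchoredPencil` (forget the tensor clause; an elliptic curve
  exists in the tree), so all its `InvariantCyclesHoldFor`-rows are recovered;
* §1 **`mem_algebraicClasses_of_isWeilTensorAnchoredPencilFor_of_door_of_anchoredCarrierAt`** — THE PER-PENCIL ENGINE (extracted from AC-f §2): the door
  for `𝒪` ∧ Weil-tensor carriers over `E₀` (`2 ≤ p ≤ d − 2`) ∧ `IsWeilTensorAnchoredPencilFor E₀ B' p w f d` ⟹ `w ∈ algebraicClasses B'.X p` (off the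
  mid-range by Lefschetz; in it: the pencil is served at its tensor fibre, the door and the carrier make `W` algebraic on every fibre of the compact pencil,
  `e₁`, `g'`, `q ≠ 0` bring it to `B'`);
* §2 **`splitWeilClass_mem_algebraicClasses_of_weilTensorPencil_of_door_of_anchoredCarrierAt`**: the new fact ∧ the door for `𝒪` ∧ ONE elliptic curve `E₀`
  with Weil-tensor carriers ⟹ for EVERY split `E`-Weil datum `(B, η, R, e₀, p, h = e^*a, w)` — `IsWeilTypeCM B η R e₀ p`, `h` an `E`-compatible
  hyperplane class, `IsHyperbolicWeilType B η (p·e₀) h`, `w ∈ W_E ⊗ ℂ` rational — and EVERY `p ≥ 1`: `w ∈ algebraicClasses B.X p` (`p = 1`: Lefschetz,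
  the class being `(1,1)` by the Moonen–Zarhin criterion, a theorem of the tree); the whole line `W_E ⊗ ℂ ≤ algebraicClasses B.X p`
  (`…weilClassesField_le_algebraicClasses…`, `W_E ⊗ ℂ` is spanned by its rational classes); the pulled-back form on any smooth projective `X ⟶ B.X`
  (the shape of the cell's K3-partner rows). NO hypothesis of CM type on `B`; `HC_CM` absent; no cell of K-SR♭∃; no curve residual;
* §3 twisted-door forms per `C` (`TwistedPerfectDoorVHC C Adm` by name);
* §4 **both axes from ONE node**: the two Weil-tensor facts ∧ the door ∧ Weil-tensor carriers over ONE `E₀` ⟹ `(∀ B, CMHodgeHypothesisAt B)` AND the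
  split Weil classes of every CM field (conjunction of §2 with AC-f §2).

HONEST: both named facts are THEOREMS IN PRINT vendored as `Prop`s (hypotheses by name; not formalised); every carrier statement is OPEN, not in
print and NOT implied by the Hodge conjecture; the door is the road's binder (labels: route file; `bfSingleAdmissible` disjunct print-supported for
`B₀ = 0` or initial-segment degree sets, RING2-MAP §AbelianAll AA2.487). In print the conclusion of §2 is OPEN in every dimension `2p·e₀ ≥ 8`
(Markman, arXiv:2502.03415 §1.2: split, `K` quadratic, dimension `≥ 8` — nothing known; arXiv:2509.23403 §12: `[K:ℚ] > 2` — nothing known; known: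
`p·e₀ ≤ 3` quadratic split sixfolds, Markman Thm. 1.5.1, PREPRINT). Nothing here says any carrier, door, Weil class, `HC_CM`, `HC_AV` or HC holds.
References: [cite: Andre1996Motifs, §6.3 b) (p. 32), Lemme 6.3.3 and proof (p. 33), Remarque 2] [cite: Deligne1982HodgeCycles, §4 Cor. 4.2, Thm. 4.8 (b),
Remark 4.10] [cite: MoonenZarhin1998WeilClasses, §1] [cite: vanGeemen1994HodgeAV, 4.9, Lemma 5.2] [cite: Bloch1972Semiregularity, Remark (7.5)]
[cite: BuchweitzFlenner2003, §5 Thm. 5.1] [cite: Markman2025SecantWeil, §1.2] [cite: Markman2025SurveySecant, §12].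
-/

noncomputable section

open CategoryTheory CategoryTheory.Limits AlgebraicGeometry Topology

namespace Summit.HodgeConjecture.HodgeConjecture.Ring2.SemiregularRepresentatives

-- the cell's namespace repeats the summit name (`Summit.HodgeConjecture.HodgeConjecture…`), as in every `Ring2*` file
set_option linter.dupNamespace false

open Literature.AlgebraicGeometry Literature.AlgebraicGeometry.Motives
open Literature.AlgebraicGeometry.HodgeTheory
open Literature.AlgebraicGeometry.Deligne1982
open Literature.AlgebraicGeometry.VanGeemen1994 (pullbackOne)
open Literature.AlgebraicTopology.SingularHomology
open Literature.Barriers.HodgeConjecture (divisorClassesSpan)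
open Literature.AlgebraicGeometry.Andre1996 (andre1996_cmHodgeClasses_weilTensorPencils andre1996_splitWeilClasses_weilTensorPencil
  andre1996_splitWeilClasses_algebraicallyAnchoredPencil IsWeilTensorAnchoredPencilFor IsAlgebraicallyAnchoredPencilFor)
open Literature.AlgebraicGeometry.Milne1999 (IsOfCMType CMHodgeHypothesisAt)
open Summit.Ventures.HSemireg (ObjClass LocalVariationalHodgeFor)
open Summit.HodgeConjecture.HodgeConjecture.Ring2.AbelianAll (ellipticPowerPolarisedAnchorOf weilStructureServedClasses)

/-! ## §0 The new named fact refines the literature seat's fact -/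

/-- **The split Weil-tensor fact implies `andre1996_splitWeilClasses_algebraicallyAnchoredPencil`**: instantiate at ANY elliptic curve (one exists in
the tree, `HodgeTheory.exists_abelianVariety_dim_one_cupProduct_ne_zero`) and forget the clause at `s₀`.
[cite: Andre1996Motifs, Lemme 6.3.3 (p. 33)] -/
theorem andre1996_splitWeilClasses_algebraicallyAnchoredPencil_of_weilTensorPencil (h : andre1996_splitWeilClasses_weilTensorPencil) :
    andre1996_splitWeilClasses_algebraicallyAnchoredPencil := by
  intro R e₀ p hp n B η e a w hB ha hRos hsplit hw hwQ
  obtain ⟨E₀, hE₀, -⟩ := exists_abelianVariety_dim_one_cupProduct_ne_zero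
  obtain ⟨𝒳, S, f, hf⟩ := h E₀ hE₀ R e₀ p hp n B η e a w hB ha hRos hsplit hw hwQ
  refine ⟨𝒳, S, f, fun j ↦ ?_⟩
  obtain ⟨hf', s₁, s₀, W, A₁, e₁, g', q, hW, hq, hgw, halg, -⟩ := hf j
  exact ⟨hf', s₁, s₀, W, A₁, e₁, g', q, hW, hq, hgw, halg⟩

variable {𝒪 : ObjClass}

/-! ## §1 The per-pencil engine: a Weil-tensor anchored pencil, the door and the carriers make `w` algebraic -/

/-- **THE PER-PENCIL ENGINE.** The door for `𝒪` ∧ an elliptic curve `E₀` with Weil-tensor carriers («for all `d`, `p`, `2 ≤ p ≤ d − 2`: on every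
`X ≅` an abelian `d`-fold isogenous to a power of `E₀`, for every polarisation class `θ` and every rational `(p,p)` class that is an `E`-Weil class of a
CM-field structure, an `𝒪`-datum with `κ_p = a·w + c_p·θᵖ`, `a ≠ 0`, sides on the `θ`-ray») ∧ a compact pencil `f` of relative dimension `d` with
`IsWeilTensorAnchoredPencilFor E₀ B' p w f d` ⟹ `w ∈ algebraicClasses B'.X p`. Off the mid-range (`p ≤ 1` or `d ≤ p + 1`) `W|_{X_{s₁}}` is algebraic by
Lefschetz; in it the pencil is SERVED at its tensor fibre (AC-f §1 `hasServedFibre_compactPencil_of_weilTensorFibre`), so the door and the carrier make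
`W` algebraic on EVERY fibre (`mem_algebraicClasses_compactPencil_of_anchoredCarrierAt_of_hasServedFibre`); across `e₁`, back along `g'`, divide by `q`.
[cite: Andre1996Motifs, Lemme 6.3.3 and proof (p. 33), Remarque 2] [cite: Bloch1972Semiregularity, Remark (7.5)] [cite: BuchweitzFlenner2003, §5 Thm. 5.1] -/
theorem mem_algebraicClasses_of_isWeilTensorAnchoredPencilFor_of_door_of_anchoredCarrierAt (hT : LocalVariationalHodgeFor 𝒪)
    {E₀ : AbelianVariety ℂ}
    (hcar : ∀ d p : ℕ, 2 ≤ p → p + 2 ≤ d → AnchoredCarrierAt 𝒪 d p (ellipticPowerPolarisedAnchorOf E₀ d) (weilStructureServedClasses d p))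
    {B' : AbelianVariety ℂ} {p : ℕ} {w : complexBetti B'.X (2 * p)} {𝒳 S : SchemeOver ℂ} {f : 𝒳 ⟶ S} {d : ℕ}
    (hf : IsWeilTensorAnchoredPencilFor E₀ B' p w f d) : w ∈ algebraicClasses B'.X p := by
  obtain ⟨hf, s₁, s₀, W, A₁, e₁, g', q, hW, hq, hgw, -, A₀, e₀, N, ψ₀, hiso, hweil⟩ := hf
  -- `W` is algebraic on the fibre `𝒳_{s₁}`: off the mid-range of `d` by Lefschetz, in it by the door and the Weil-tensor carriers
  have h₁ : complexBetti.map (fiberι f s₁) (2 * p) W ∈ algebraicClasses (fiberOver f s₁) p := by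
    by_cases hoff : p ≤ 1 ∨ d ≤ p + 1
    · exact (mem_algebraicClasses_and_divisorClassesSpan_of_offMidRange (hf.isSmoothProjectiveFamily.isSmoothProjective s₁) hoff _
        (hW s₁).1 (hW s₁).2).1
    · exact mem_algebraicClasses_compactPencil_of_anchoredCarrierAt_of_hasServedFibre hT (hcar d p (by omega) (by omega)) hf W hW
        (hasServedFibre_compactPencil_of_weilTensorFibre hf e₀ ψ₀ hiso W hW hweil) s₁
  -- across `e₁`, back along `g'`, divide by `q`
  have h₂ : complexBetti.map e₁.hom (2 * p) (complexBetti.map (fiberι f s₁) (2 * p) W) ∈ algebraicClasses A₁.X p :=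
    (mem_algebraicClasses_map_iff_of_iso e₁).2 h₁
  have h₃ : (q : ℂ) • w ∈ algebraicClasses B'.X p := by
    rw [← hgw]
    exact map_mem_algebraicClasses_of_abelianVariety AbelianVariety.isSmoothProjective_holds A₁ g'.hom.hom.hom h₂
  exact (Submodule.smul_mem_iff _ (Rat.cast_ne_zero.2 hq)).1 h₃

/-! ## §2 Split `E`-Weil classes, every CM field, from the new fact, the door and Weil-tensor carriers over ONE elliptic curve -/

section Split

variable {B : AbelianVariety ℂ} {η : B ⟶ B} {R : Polynomial ℤ} {e₀ p : ℕ}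
  {e : ProjectiveEmbedding B.X} {a : complexBetti (projectiveSpace e.n ℂ) 2}
  {w : complexBetti B.X (2 * p)}

/-- **SPLIT `E`-WEIL CLASSES ARE ALGEBRAIC, for EVERY CM field `E` and EVERY `p ≥ 1`, from Lemme 6.3.3 (tensor form), the door and carriers for
`E`-WEIL classes at `E`-TENSOR points over ONE elliptic curve** — NO hypothesis of CM type on `B`, NO `HC_CM`: for `(B, η)` of Weil type relative to
`E = ℚ(η) ≅ ℚ[T]/(R(T²))` (`IsWeilTypeCM B η R e₀ p`), an `E`-compatible hyperplane class `h = e^*a` which is split (`IsHyperbolicWeilType`, André's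
`(*)`), and a rational `w ∈ W_E ⊗ ℂ`: `w ∈ algebraicClasses B.X p`. `p = 1`: «le théorème classique de Lefschetz» (`w` is `(1,1)` by the Moonen–Zarhin
criterion, discharged in the tree); `p > 1`: the fact's pencil at our `E₀` and §1. In print OPEN for `2p·e₀ ≥ 8` (Markman §1.2, §12).
[cite: Andre1996Motifs, §6.3 b)–c) (pp. 32–33)] [cite: MoonenZarhin1998WeilClasses, §1 (Criterion)] [cite: Markman2025SecantWeil, §1.2]
[cite: Bloch1972Semiregularity, Remark (7.5)] -/
theorem splitWeilClass_mem_algebraicClasses_of_weilTensorPencil_of_door_of_anchoredCarrierAt (h : andre1996_splitWeilClasses_weilTensorPencil)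
    (hT : LocalVariationalHodgeFor 𝒪) {E₀ : AbelianVariety ℂ} (hE₀ : E₀.dim = 1)
    (hcar : ∀ d p : ℕ, 2 ≤ p → p + 2 ≤ d → AnchoredCarrierAt 𝒪 d p (ellipticPowerPolarisedAnchorOf E₀ d) (weilStructureServedClasses d p))
    (hB : IsWeilTypeCM B η R e₀ p) (hp : 0 < p) (ha : IsRationalClass a) (ha₀ : a ≠ 0)
    (hRos : ∀ x y : complexBetti B.X 1,
      polarizationPairingOne B.X (complexBetti.map e.ι 2 a) (B.dim - 1) (pullbackOne B η x) y =
        -polarizationPairingOne B.X (complexBetti.map e.ι 2 a) (B.dim - 1) x (pullbackOne B η y))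
    (hsplit : IsHyperbolicWeilType B η (p * e₀) (complexBetti.map e.ι 2 a))
    (hw : w ∈ weilClassesField B η (R.comp (Polynomial.X ^ 2)) (2 * p)) (hwQ : IsRationalClass w) :
    w ∈ algebraicClasses B.X p := by
  obtain _ | _ | p := p
  · exact absurd hp (lt_irrefl 0)
  · -- `p = 1`: Weil classes are of type `(1,1)` (Moonen–Zarhin, discharged) and Lefschetz `(1,1)`
    exact lefschetzOneOne_rational_holds hB.isSmoothProjective w hwQ
      (hB.isOfHodgeType_of_mem_weilClassesField MoonenZarhin1998_weilClasses_hodgeCriterion_holds hw)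
  · -- `p > 1`: the Weil-tensor anchored pencil at `E₀`, and the engine of §1
    obtain ⟨𝒳, S, f, hf⟩ := h E₀ hE₀ R e₀ (p + 2) (by omega) 1 (fun _ => B) (fun _ => η) (fun _ => e) (fun _ => a)
      (fun _ => w) (fun _ => hB) (fun _ => ⟨ha, ha₀⟩) (fun _ => hRos) (fun _ => hsplit) (fun _ => hw) (fun _ => hwQ)
    exact mem_algebraicClasses_of_isWeilTensorAnchoredPencilFor_of_door_of_anchoredCarrierAt hT hcar (hf 0)

/-- **The whole line `W_E ⊗ ℂ` is algebraic** (it is spanned by its rational classes): under the hypotheses of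
`splitWeilClass_mem_algebraicClasses_of_weilTensorPencil_of_door_of_anchoredCarrierAt` on `(B, η, h)`,
`weilClassesField B η (R(T²)) (2p) ≤ algebraicClasses B.X p`. [cite: MoonenZarhin1998WeilClasses, §1 Lemma (1)] [cite: Andre1996Motifs, §6.3 c) (p. 33)] -/
theorem weilClassesField_le_algebraicClasses_of_split_of_weilTensorPencil_of_door_of_anchoredCarrierAt
    (h : andre1996_splitWeilClasses_weilTensorPencil) (hT : LocalVariationalHodgeFor 𝒪) {E₀ : AbelianVariety ℂ} (hE₀ : E₀.dim = 1)
    (hcar : ∀ d p : ℕ, 2 ≤ p → p + 2 ≤ d → AnchoredCarrierAt 𝒪 d p (ellipticPowerPolarisedAnchorOf E₀ d) (weilStructureServedClasses d p))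
    (hB : IsWeilTypeCM B η R e₀ p) (ha : IsRationalClass a) (ha₀ : a ≠ 0)
    (hRos : ∀ x y : complexBetti B.X 1,
      polarizationPairingOne B.X (complexBetti.map e.ι 2 a) (B.dim - 1) (pullbackOne B η x) y =
        -polarizationPairingOne B.X (complexBetti.map e.ι 2 a) (B.dim - 1) x (pullbackOne B η y))
    (hsplit : IsHyperbolicWeilType B η (p * e₀) (complexBetti.map e.ι 2 a)) :
    weilClassesField B η (R.comp (Polynomial.X ^ 2)) (2 * p) ≤ algebraicClasses B.X p :=
  hB.weilClassesField_le_algebraicClasses_of_forall_isRationalClass fun _ hc hcQ ↦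
    splitWeilClass_mem_algebraicClasses_of_weilTensorPencil_of_door_of_anchoredCarrierAt h hT hE₀ hcar hB hB.k_pos ha ha₀ hRos hsplit hc hcQ

/-- **The pulled-back form** (the shape consumed by the cell's K3-partner rows): under the same hypotheses, `g^* w` is algebraic on every smooth
projective `X` for every morphism `g : X ⟶ B.X` (Fulton 19.2 (b) on abelian targets, `map_mem_algebraicClasses_of_abelianVariety`).
[cite: Andre1996Motifs, §6.3 c) and Remarque 2 (p. 33)] [cite: Fulton1998, §19.2 Cor. 19.2 (b)] -/
theorem splitWeilClass_map_mem_algebraicClasses_of_weilTensorPencil_of_door_of_anchoredCarrierAt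
    (h : andre1996_splitWeilClasses_weilTensorPencil) (hT : LocalVariationalHodgeFor 𝒪) {E₀ : AbelianVariety ℂ} (hE₀ : E₀.dim = 1)
    (hcar : ∀ d p : ℕ, 2 ≤ p → p + 2 ≤ d → AnchoredCarrierAt 𝒪 d p (ellipticPowerPolarisedAnchorOf E₀ d) (weilStructureServedClasses d p))
    (hB : IsWeilTypeCM B η R e₀ p) (hp : 0 < p) (ha : IsRationalClass a) (ha₀ : a ≠ 0)
    (hRos : ∀ x y : complexBetti B.X 1,
      polarizationPairingOne B.X (complexBetti.map e.ι 2 a) (B.dim - 1) (pullbackOne B η x) y =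
        -polarizationPairingOne B.X (complexBetti.map e.ι 2 a) (B.dim - 1) x (pullbackOne B η y))
    (hsplit : IsHyperbolicWeilType B η (p * e₀) (complexBetti.map e.ι 2 a))
    (hw : w ∈ weilClassesField B η (R.comp (Polynomial.X ^ 2)) (2 * p)) (hwQ : IsRationalClass w)
    {m : ℕ} {X : SchemeOver ℂ} (hX : IsSmoothProjective m X) (g : X ⟶ B.X) :
    complexBetti.map g (2 * p) w ∈ algebraicClasses X p :=
  map_mem_algebraicClasses_of_abelianVariety hX B g
    (splitWeilClass_mem_algebraicClasses_of_weilTensorPencil_of_door_of_anchoredCarrierAt h hT hE₀ hcar hB hp ha ha₀ hRos hsplit hw hwQ)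

end Split

/-! ## §3 Twisted-door forms, per `C` -/

/-- **Twisted-door form of §2, per `C`** (route binder `TwistedPerfectDoorVHC C Adm` by name, any admissibility notion `Adm`).
[cite: Andre1996Motifs, Lemme 6.3.3 and proof (p. 33)] [cite: Pridham2024Semiregularity, Cor. 2.25 and Rem. 2.26–2.27] [cite: BuchweitzFlenner2003, §5 Thm. 5.1] -/
theorem splitWeilClass_mem_algebraicClasses_of_weilTensorPencil_of_twistedPerfectDoorVHC_of_anchoredCarrierAt {C : ChernCharacterBetti}
    {Adm : PerfectAdmissibility} (h : andre1996_splitWeilClasses_weilTensorPencil) (hT : TwistedPerfectDoorVHC C Adm) {E₀ : AbelianVariety ℂ}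
    (hE₀ : E₀.dim = 1)
    (hcar : ∀ d p : ℕ, 2 ≤ p → p + 2 ≤ d →
      AnchoredCarrierAt (twistedReflexiveClass C Adm) d p (ellipticPowerPolarisedAnchorOf E₀ d) (weilStructureServedClasses d p))
    {B : AbelianVariety ℂ} {η : B ⟶ B} {R : Polynomial ℤ} {e₀ p : ℕ} {e : ProjectiveEmbedding B.X}
    {a : complexBetti (projectiveSpace e.n ℂ) 2} {w : complexBetti B.X (2 * p)}
    (hB : IsWeilTypeCM B η R e₀ p) (hp : 0 < p) (ha : IsRationalClass a) (ha₀ : a ≠ 0)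
    (hRos : ∀ x y : complexBetti B.X 1,
      polarizationPairingOne B.X (complexBetti.map e.ι 2 a) (B.dim - 1) (pullbackOne B η x) y =
        -polarizationPairingOne B.X (complexBetti.map e.ι 2 a) (B.dim - 1) x (pullbackOne B η y))
    (hsplit : IsHyperbolicWeilType B η (p * e₀) (complexBetti.map e.ι 2 a))
    (hw : w ∈ weilClassesField B η (R.comp (Polynomial.X ^ 2)) (2 * p)) (hwQ : IsRationalClass w) :
    w ∈ algebraicClasses B.X p :=
  splitWeilClass_mem_algebraicClasses_of_weilTensorPencil_of_door_of_anchoredCarrierAt h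
    ((twistedPerfectDoorVHC_iff_localVariationalHodgeFor C Adm).1 hT) hE₀ hcar hB hp ha ha₀ hRos hsplit hw hwQ

/-! ## §4 Both axes from ONE node: `HC_CM` and the split Weil classes of every CM field -/

/-- **ONE carrier node, TWO axes.** The two Weil-tensor facts (Lemmes 6.3.2 + 6.3.3 for CM varieties; Lemme 6.3.3 alone for split Weil data) ∧ the door
for `𝒪` ∧ ONE elliptic curve `E₀` with Weil-tensor carriers ⟹ (`CMHodgeHypothesisAt B` for every `B`) ∧ (every rational Weil class of every split
`E`-Weil structure, every CM field `E`, every `p ≥ 1`, is algebraic). [cite: Andre1996Motifs, §6.3 Lemmes 6.3.2–6.3.3 (pp. 32–33)]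
[cite: Bloch1972Semiregularity, Remark (7.5)] [cite: Milne1999, §7 p. 72] -/
theorem cmHodge_and_splitWeil_of_weilTensorPencils_of_door_of_anchoredCarrierAt (h₂₂ : andre1996_cmHodgeClasses_weilTensorPencils)
    (h₃₃ : andre1996_splitWeilClasses_weilTensorPencil) (hT : LocalVariationalHodgeFor 𝒪) {E₀ : AbelianVariety ℂ} (hE₀ : E₀.dim = 1)
    (hcar : ∀ d p : ℕ, 2 ≤ p → p + 2 ≤ d → AnchoredCarrierAt 𝒪 d p (ellipticPowerPolarisedAnchorOf E₀ d) (weilStructureServedClasses d p)) :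
    (∀ B : AbelianVariety ℂ, CMHodgeHypothesisAt B) ∧
      ∀ (B : AbelianVariety ℂ) (η : B ⟶ B) (R : Polynomial ℤ) (e₀ p : ℕ) (e : ProjectiveEmbedding B.X)
        (a : complexBetti (projectiveSpace e.n ℂ) 2), IsWeilTypeCM B η R e₀ p → IsRationalClass a → a ≠ 0 →
        (∀ x y : complexBetti B.X 1,
          polarizationPairingOne B.X (complexBetti.map e.ι 2 a) (B.dim - 1) (pullbackOne B η x) y =
            -polarizationPairingOne B.X (complexBetti.map e.ι 2 a) (B.dim - 1) x (pullbackOne B η y)) →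
        IsHyperbolicWeilType B η (p * e₀) (complexBetti.map e.ι 2 a) →
          ∀ w ∈ weilClassesField B η (R.comp (Polynomial.X ^ 2)) (2 * p), IsRationalClass w → w ∈ algebraicClasses B.X p :=
  ⟨cmHodgeHypothesisAt_of_weilTensorPencils_of_door_of_anchoredCarrierAt h₂₂ hT hE₀ hcar,
    fun _ _ _ _ _ _ _ hB ha ha₀ hRos hsplit _ hw hwQ ↦
      splitWeilClass_mem_algebraicClasses_of_weilTensorPencil_of_door_of_anchoredCarrierAt h₃₃ hT hE₀ hcar hB hB.k_pos ha ha₀ hRos hsplit hw hwQ⟩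

end Summit.HodgeConjecture.HodgeConjecture.Ring2.SemiregularRepresentatives

end
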